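/- LEAD seat `ym-line-cbag-p1` (prover-ym-line-cbag-p1-g28-0), LINE 7 `GlueballBandRecursion`, item ⟨stmt-QuantumFields-22957⟩
`OneParticleBlochSymbolFamily`: the CONCRETE periodic Hermitian symbol of a torus hopping kernel in the LEAD's `Site 3 N`/`Tor` formalism
(`…BlochMatrices`, `…BlochTransfer`) — the object the one-stub skeleton of the item will exhibit for `Bt`.  Route-independent helper. -/
import Summits.QuantumFields.YangMills.Theorems.GlueballBandRecursionBlochTransfer

/-!
# Route `GlueballBandRecursion`, item `OneParticleBlochSymbolFamily` (stmt-QuantumFields-22957): the symmetrised trigonometric symbol of a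
# torus kernel — periodic, Hermitian, equal to the Bloch matrices at the lattice angles, with continuous Rayleigh quotients

For a real matrix kernel `J : Site 3 N → Mat_n(ℝ)` on the discrete torus `(ℤ/N)³` (the normalised hopping kernel `transferKernel r β N ψ`
of a covariant frame, `…BlochTransfer`), put `S_J(q) = Σ_z e^{i q·z̃} J(z)` (`z̃ = valMinAbs` coordinatewise, the centred representative)
and the **symmetrised symbol** `B̃_J(q) = ½(S_J(q) + S_J(q)ᴴ)` on `ℝ³`.  This file proves exactly the non-analytic clauses that
`Band.EffectiveBlochSymbolFamily` asks of `Bt := B̃_J`: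
* `kernelSymbol_isHermitian` (every `q`), `kernelSymbol_periodic` (`B̃(q + 2πz) = B̃(q)`, the def's clause verbatim);
* `sitePhase_latticeAngle`: at a lattice angle `θ_p = latticeAngle N p` the centred phase is the torus character,
  `e^{iθ_p·z̃} = chi (cubeToSite p) z` (`…BlochTransfer.chi_cubeToSite`), hence `kernelTrigSum_latticeAngle`:
  `S_J(θ_p) = blochMatrix J (cubeToSite p)` and, for a reflection-symmetric kernel, `kernelSymbol_latticeAngle`:
  **`B̃_J(θ_p) = B̂(cubeToSite p)`** — in particular `kernelSymbol_transferKernel_latticeAngle` for the transfer kernel of a covariant frame;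
* `re_inner_kernelSymbol`: the Rayleigh quotients of `B̃_J` are those of `S_J`, `Re⟪u, B̃_J(q)u⟫ = Re⟪u, S_J(q)u⟫ = Σ_z Re(e^{iq·z̃}⟪u, J(z)u⟫)`
  (`re_inner_kernelTrigSum`), a finite trigonometric sum — the form in which stub S3 (`…SymbolRegularity`, w5) delivers (P1)/(P2);
* `continuous_rayleigh_kernelSymbol`: `(q, u) ↦ Re⟪u, B̃_J(q)u⟫` is continuous (so its supremum over the period cell × unit sphere is
  attained — clause (P3)).
Symmetrising is how the antipodal sites (`2z = 0`, `N` even), where `z ↦ z̃` is not odd, are kept from spoiling Hermitian symmetry off the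
lattice angles; on the lattice angles nothing changes.

HONEST FRAMING.  Trigonometric bookkeeping for the conditional skeleton of the XL item 22957 (strong-coupling RECORD rung line); nothing about
the item, the rung `ColdDoublingRecursionStrongCoupling` or the Yang–Mills mass gap is proved here.
-/

set_option autoImplicit false

noncomputable section

open scoped InnerProductSpace BigOperators ComplexConjugate Matrix
open Finset MeasureTheory
open Literature.MathematicalPhysics.QuantumFieldTheory
open Literature.MathematicalPhysics.QuantumFieldTheory.Balaban1983to89.B5Prop11Plancherel (Tor chi)

namespace Summit.QuantumFields.YangMills.Theorems.GlueballBandRecursion.Band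

open Bloch

variable {N : ℕ} {n : ℕ}

/-! ### §1 The centred phases and the trigonometric sum of a torus kernel -/

/-- The centred phase `e^{i q·z̃}`, `z̃_μ = valMinAbs (z_μ) ∈ (−N/2, N/2]` the representative of least absolute value. -/
def sitePhase (q : Fin 3 → ℝ) (z : Site 3 N) : ℂ :=
  Complex.exp (Complex.I * (∑ μ : Fin 3, q μ * ((z μ).valMinAbs : ℝ) : ℝ))

/-- Periodicity of the centred phases: `e^{i(q + 2πk)·z̃} = e^{iq·z̃}` for `k ∈ ℤ³`. -/
theorem sitePhase_periodic (q : Fin 3 → ℝ) (k : Fin 3 → ℤ) (z : Site 3 N) :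
    sitePhase (fun i => q i + 2 * Real.pi * k i) z = sitePhase q z := by
  unfold sitePhase
  have h : (∑ μ : Fin 3, (q μ + 2 * Real.pi * k μ) * ((z μ).valMinAbs : ℝ)) =
      (∑ μ : Fin 3, q μ * ((z μ).valMinAbs : ℝ)) + 2 * Real.pi * ((∑ μ, k μ * (z μ).valMinAbs : ℤ) : ℝ) := by
    push_cast
    rw [Finset.mul_sum, ← Finset.sum_add_distrib]
    exact Finset.sum_congr rfl fun μ _ => by ring
  rw [h, Complex.ofReal_add, mul_add, Complex.exp_add]
  have h1 : Complex.exp (Complex.I * ((2 * Real.pi * ((∑ μ, k μ * (z μ).valMinAbs : ℤ) : ℝ) : ℝ) : ℂ)) = 1 := by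
    have := Complex.exp_int_mul_two_pi_mul_I (∑ μ, k μ * (z μ).valMinAbs)
    rw [← this]
    congr 1
    push_cast
    ring
  rw [h1, mul_one]

/-- The centred phase is continuous in the momentum. -/
theorem continuous_sitePhase (z : Site 3 N) : Continuous fun q : Fin 3 → ℝ => sitePhase q z := by
  unfold sitePhase
  refine Complex.continuous_exp.comp (continuous_const.mul (Complex.continuous_ofReal.comp ?_))
  exact continuous_finsetSum _ fun μ _ => (continuous_apply μ).mul continuous_const

variable [NeZero N]

/-- The trigonometric sum `S_J(q) = Σ_z e^{i q·z̃} J(z)` of a real torus kernel (complex `n × n` matrix). -/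
def kernelTrigSum (J : Site 3 N → Matrix (Fin n) (Fin n) ℝ) (q : Fin 3 → ℝ) : Matrix (Fin n) (Fin n) ℂ :=
  ∑ z, sitePhase q z • (J z).map Complex.ofReal

/-- The **symmetrised symbol** `B̃_J(q) = ½(S_J(q) + S_J(q)ᴴ)`. -/
def kernelSymbol (J : Site 3 N → Matrix (Fin n) (Fin n) ℝ) (q : Fin 3 → ℝ) : Matrix (Fin n) (Fin n) ℂ :=
  (1 / 2 : ℂ) • (kernelTrigSum J q + (kernelTrigSum J q)ᴴ)

/-- The symmetrised symbol is Hermitian at every `q`. -/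
theorem kernelSymbol_isHermitian (J : Site 3 N → Matrix (Fin n) (Fin n) ℝ) (q : Fin 3 → ℝ) : (kernelSymbol J q).IsHermitian := by
  unfold kernelSymbol Matrix.IsHermitian
  rw [Matrix.conjTranspose_smul, Matrix.conjTranspose_add, Matrix.conjTranspose_conjTranspose, add_comm]
  congr 1
  rw [Complex.star_def, map_div₀, map_one, map_ofNat]

/-- Periodicity of the trigonometric sum. -/
theorem kernelTrigSum_periodic (J : Site 3 N → Matrix (Fin n) (Fin n) ℝ) (q : Fin 3 → ℝ) (k : Fin 3 → ℤ) :
    kernelTrigSum J (fun i => q i + 2 * Real.pi * k i) = kernelTrigSum J q := by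
  unfold kernelTrigSum
  exact Finset.sum_congr rfl fun z _ => by rw [sitePhase_periodic]

/-- **Periodicity of the symbol** — the clause `∀ q z, Bt (fun i => q i + 2 * Real.pi * z i) = Bt q` of `EffectiveBlochSymbolFamily`. -/
theorem kernelSymbol_periodic (J : Site 3 N → Matrix (Fin n) (Fin n) ℝ) (q : Fin 3 → ℝ) (k : Fin 3 → ℤ) :
    kernelSymbol J (fun i => q i + 2 * Real.pi * k i) = kernelSymbol J q := by
  unfold kernelSymbol
  rw [kernelTrigSum_periodic]

/-! ### §2 At the lattice angles the symbol is the Bloch matrix -/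

/-- **Centred phases at lattice angles are the torus characters**: `e^{iθ_p·z̃} = chi (cubeToSite p) z` — the phase only sees
`z̃ ≡ z (mod N)`. -/
theorem sitePhase_latticeAngle (p : Fin N × Fin N × Fin N) (z : Site 3 N) :
    sitePhase (latticeAngle N p) z = chi (fun _ : Fin 3 => N) (cubeToSite p) z := by
  rw [chi_cubeToSite, sitePhase]
  have hN : (N : ℝ) ≠ 0 := Nat.cast_ne_zero.2 (NeZero.ne N)
  -- coordinatewise `val = valMinAbs + (0 or N)`, and `θ_p(μ)·N = 2π p_μ`
  have hcoord : ∀ μ : Fin 3, ∃ m : ℤ,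
      latticeAngle N p μ * (((z μ).val : ℕ) : ℝ) = latticeAngle N p μ * ((z μ).valMinAbs : ℝ) + 2 * Real.pi * m := by
    intro μ
    have hv := ZMod.val_eq_ite_valMinAbs (z μ)
    by_cases hle : (z μ).val ≤ N / 2
    · refine ⟨0, ?_⟩
      simp only [hle, if_true, Nat.cast_zero, add_zero] at hv
      have : (((z μ).val : ℕ) : ℝ) = ((z μ).valMinAbs : ℝ) := by exact_mod_cast hv
      rw [this]
      simp
    · refine ⟨((coordsF p μ).val : ℤ), ?_⟩
      simp only [hle, if_false] at hv
      have : (((z μ).val : ℕ) : ℝ) = ((z μ).valMinAbs : ℝ) + N := by exact_mod_cast hv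
      rw [this, latticeAngle]
      push_cast
      field_simp
  choose m hm using hcoord
  have hsum : (∑ μ : Fin 3, latticeAngle N p μ * (((z μ).val : ℕ) : ℝ)) =
      (∑ μ : Fin 3, latticeAngle N p μ * ((z μ).valMinAbs : ℝ)) + 2 * Real.pi * ((∑ μ, m μ : ℤ) : ℝ) := by
    push_cast
    rw [Finset.mul_sum, ← Finset.sum_add_distrib]
    exact Finset.sum_congr rfl fun μ _ => hm μ
  rw [hsum, Complex.ofReal_add, mul_add, Complex.exp_add]
  have h1 : Complex.exp (Complex.I * ((2 * Real.pi * ((∑ μ, m μ : ℤ) : ℝ) : ℝ) : ℂ)) = 1 := by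
    have := Complex.exp_int_mul_two_pi_mul_I (∑ μ, m μ)
    rw [← this]
    congr 1
    push_cast
    ring
  rw [h1, mul_one]

/-- **The trigonometric sum at a lattice angle is the Bloch matrix**: `S_J(θ_p) = B_J(cubeToSite p)` (`blochMatrix` of `…BlochMatrices`). -/
theorem kernelTrigSum_latticeAngle (J : Site 3 N → Matrix (Fin n) (Fin n) ℝ) (p : Fin N × Fin N × Fin N) :
    kernelTrigSum J (latticeAngle N p) =
      blochMatrix (fun _ : Fin 3 => N) n (fun z => (J z).map Complex.ofReal) (cubeToSite p) := by
  unfold kernelTrigSum blochMatrix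
  exact Finset.sum_congr rfl fun z _ => by rw [sitePhase_latticeAngle]

/-- For a reflection-symmetric real kernel (`J(−z) = J(z)ᵀ`) the Bloch matrices are Hermitian, so the symmetrised symbol agrees with
them at the lattice angles: `B̃_J(θ_p) = B_J(cubeToSite p)`. -/
theorem kernelSymbol_latticeAngle {J : Site 3 N → Matrix (Fin n) (Fin n) ℝ} (hJ : ∀ z, J (-z) = (J z)ᵀ)
    (p : Fin N × Fin N × Fin N) :
    kernelSymbol J (latticeAngle N p) =
      blochMatrix (fun _ : Fin 3 => N) n (fun z => (J z).map Complex.ofReal) (cubeToSite p) := by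
  have hH := blochMatrix_isHermitian (N := fun _ : Fin 3 => N) (h := fun z => (J z).map Complex.ofReal) (map_ofReal_reflect hJ)
    (cubeToSite p)
  rw [kernelSymbol, kernelTrigSum_latticeAngle, hH.eq, ← two_smul ℂ, smul_smul]
  norm_num

section Transfer

variable {G : Type} [Group G] [TopologicalSpace G] [IsTopologicalGroup G] [CompactSpace G] [MeasurableSpace G] [BorelSpace G]

/-- **The symbol of the transfer kernel of a covariant frame takes the value `B̂(cubeToSite p)` at `latticeAngle N p`** — the bridge from
the def's `Bt (latticeAngle N p)` to the Bloch blocks of `…BlochTransfer` (whose traces of powers are the band power sums,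
`transfer_bloch_reduction`, and sit under `traceExcess`, `sum_cube_re_trace_transferBloch_pow_le_traceExcess`). -/
theorem kernelSymbol_transferKernel_latticeAngle (r : LatticeRep G) (β : ℝ) (N : ℕ) [NeZero N] {n : ℕ}
    {ψ : Site 3 N × Fin n → Lp ℝ 2 (Measure.pi fun _ : Edge 3 N => haarProbability G)}
    (hcov : ∀ (v x : Site 3 N) (j : Fin n), ψ (v + x, j) = koopmanTranslate N v (ψ (x, j)))
    (p : Fin N × Fin N × Fin N) :
    kernelSymbol (transferKernel r β N ψ) (latticeAngle N p) = transferBloch r β N ψ (cubeToSite p) :=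
  kernelSymbol_latticeAngle (transferKernel_reflect r β N hcov) p

end Transfer

/-! ### §3 Rayleigh quotients of the symbol: the finite trigonometric sum, and continuity -/

/-- `Re⟪u, Aᴴ u⟫ = Re⟪u, A u⟫` for a square complex matrix. -/
theorem re_inner_toEuclideanLin_conjTranspose (A : Matrix (Fin n) (Fin n) ℂ) (u : EuclideanSpace ℂ (Fin n)) :
    RCLike.re ⟪u, Matrix.toEuclideanLin Aᴴ u⟫_ℂ = RCLike.re ⟪u, Matrix.toEuclideanLin A u⟫_ℂ := by
  rw [Matrix.toEuclideanLin_conjTranspose_eq_adjoint, LinearMap.adjoint_inner_right, ← inner_conj_symm, RCLike.conj_re]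

/-- **The Rayleigh quotients of the symmetrised symbol are those of the trigonometric sum**: `Re⟪u, B̃_J(q)u⟫ = Re⟪u, S_J(q)u⟫`. -/
theorem re_inner_kernelSymbol (J : Site 3 N → Matrix (Fin n) (Fin n) ℝ) (q : Fin 3 → ℝ) (u : EuclideanSpace ℂ (Fin n)) :
    RCLike.re ⟪u, Matrix.toEuclideanLin (kernelSymbol J q) u⟫_ℂ =
      RCLike.re ⟪u, Matrix.toEuclideanLin (kernelTrigSum J q) u⟫_ℂ := by
  rw [kernelSymbol, map_smul, map_add, LinearMap.smul_apply, LinearMap.add_apply, inner_smul_right, inner_add_right]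
  have hB := re_inner_toEuclideanLin_conjTranspose (kernelTrigSum J q) u
  have h2 : ((1 / 2 : ℂ)) = ((1 / 2 : ℝ) : ℂ) := by push_cast; ring
  rw [h2]
  simp only [RCLike.re_to_complex] at hB ⊢
  rw [Complex.re_ofReal_mul, Complex.add_re, hB]
  ring

/-- The Rayleigh quotient of the trigonometric sum as a finite sum: `Re⟪u, S_J(q)u⟫ = Σ_z Re(e^{iq·z̃}·⟪u, J(z)u⟫)`. -/
theorem re_inner_kernelTrigSum (J : Site 3 N → Matrix (Fin n) (Fin n) ℝ) (q : Fin 3 → ℝ) (u : EuclideanSpace ℂ (Fin n)) :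
    RCLike.re ⟪u, Matrix.toEuclideanLin (kernelTrigSum J q) u⟫_ℂ =
      ∑ z, RCLike.re (sitePhase q z * ⟪u, Matrix.toEuclideanLin ((J z).map Complex.ofReal) u⟫_ℂ) := by
  rw [kernelTrigSum, map_sum, LinearMap.sum_apply, inner_sum, map_sum]
  refine Finset.sum_congr rfl fun z _ => ?_
  rw [map_smul, LinearMap.smul_apply, inner_smul_right]

/-- **Joint continuity of the Rayleigh quotient** `(q, u) ↦ Re⟪u, B̃_J(q) u⟫` on `ℝ³ × ℂⁿ` (so its supremum over the period cell times
the unit sphere is attained — clause (P3) of the def). -/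
theorem continuous_rayleigh_kernelSymbol (J : Site 3 N → Matrix (Fin n) (Fin n) ℝ) :
    Continuous fun x : (Fin 3 → ℝ) × EuclideanSpace ℂ (Fin n) =>
      RCLike.re ⟪x.2, Matrix.toEuclideanLin (kernelSymbol J x.1) x.2⟫_ℂ := by
  simp_rw [re_inner_kernelSymbol, re_inner_kernelTrigSum]
  refine continuous_finsetSum _ fun z _ => RCLike.continuous_re.comp ?_
  refine ((continuous_sitePhase z).comp continuous_fst).mul ?_
  exact (continuous_snd).inner (((Matrix.toEuclideanLin ((J z).map Complex.ofReal)).continuous_of_finiteDimensional).comp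
    continuous_snd)

end Summit.QuantumFields.YangMills.Theorems.GlueballBandRecursion.Band

end
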